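import Literature.MathematicalPhysics.QuantumFieldTheory.Balaban1983to89.B8Thm4KLevelGamma
import Literature.MathematicalPhysics.QuantumFieldTheory.Balaban1983to89.B8Thm4ExistsZd3BdryBeta

/-!
# `Balaban1983to89.B8Thm4ExistsConcreteGamma` — [Balaban1985RegularSpaces] THEOREM 4 (p. 88), EXISTENCE HALF, on the `ℤᵈ × 𝔸` carriers with ONE
# threshold, EDITION γ (print's box law «box ⊂ Ω_{j−1}» for the (1.59) datum class; (1.35) in print's class) — and the window arithmetic one level lower

statement-level skeleton of published theorems with citation tags; proofs where landed; nothing here is a claim about the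
Yang–Mills mass gap

PDF held: `paper:balaban1985-cmp99-regular-spaces-gauge-fixing`; Thm 4 p. 88, (1.29)–(1.38) pp. 81–82, (1.55)–(1.62) pp. 86–87, p. 77 — read first-hand this session.

CITATION HEADER (lean-in-tree rule).  Cell `pub-ymgap` (HUMAN RULING D-0062, Track A), DAG node N05 = [B8], seat `pub-ymgap-dag-n05-e` g9; dag-lead g12 DEDUP-349 (1)
(driver edition γ = this seat).  WHY THIS FILE.  Third piece of the edition-γ driver after `B8Eq142KLevelLocalGamma` (p580875) and `B8Thm4KLevelGamma`: the
UNIFORM-THRESHOLD existence half of Theorem 4 on the concrete carriers (the shape Proposition 6's cube assembler consumes at the datum `(1, U₀″)`), with the datum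
class a parameter under print's law and the datum's (1.35) in print's class (LOCATED-AVG135, this seat: the «box ⊂ Ω_j»-guarded (1.35) of `zdGF3.avgClose166` ∕
`ineq132_cubes` cannot feed the γ driver at crossing bonds; the cube road therefore consumes THIS member-generic form directly, once the (1.133) datum lemma in
print's guard exists — dag-n05-c ∕ r05).
§0 ★ `thm4_windows_γ` — dag-n05-a's `thm4_windows` at `(L²α₀, L²α₁)` ⇒ the γ windows (`C0 d·L²α₀ ≤ 1∕3`, …, `C₂ = 16·131072(d+1)²·L²` in (1.61)'s slot).
§1 ★★ `thm4Exists_concrete_uniform_γ` — THEOREM 4's EXISTENCE HALF, one threshold `cₑ(d, L, B₀, B₀′, c_P)`, sockets `SP5base`∕`SP5`∕β-shaped `SH59Dβ` over the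
   parametric class, γ box law, print-class (1.35).
Kind «kernel-checked proof», theorems only, no `def`.  NOT IN THIS FILE (located): the `zdGF3`-family forms (`…_member_zd3_γ`, `…_zd3_map_γ`) — they would read
(1.35) from `zdGF3.avgClose166`, whose guard is «box ⊂ Ω_j» (n05-a's letter; LOCATED-AVG135) — deferred until that letter's γ edition.

HONEST SCOPE ∕ A6.  Re-assembly by name; nothing of [4]∕Props 3, 5 proved.  Hypotheses: Theorem 4's frame (inhabited), `SP5base`∕`SP5` (N05 Prop.-5 lane), and the
β-SHAPED (1.59) socket over the SUPPLIED class — false over a «box ⊂ Ω_j» class at nested members (p572834), = print's (1.59) over `cubeLamBP'` (open, named by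
dag-n05-c `Ineq159FlatCubeMemberPrinted`); no satisfiability claim here.  Count-neutral; N05 NOT discharged; one finite `𝕋⁴` programme at fixed `ε`, Bałaban as
printed; nothing continuum ∕ ℝ⁴ ∕ OS ∕ mass-gap ∕ Clay.  No `sorry`, no `def`, no `instance`, no `notation`.  Unit `pub-ymgap-dag-n05-e` (g9), 2026-08-27.
-/

noncomputable section

open NormedSpace

namespace Literature.MathematicalPhysics.QuantumFieldTheory.Balaban1983to89.B8Thm4ExistsConcreteGamma

open Complex (I)
open MatrixLog B7Prop1Explicit B7Prop2Explicit B7Prop1Local B7Eq92Concrete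
open B7Prop2Explicit (C0 c2')
open B7Prop3Flat (c3)
open B8Ineq132 (covDerivFwd InAk BondTouches)
open B8Eq119TwistedAxial (Restr129 InAx)
open B8Eq184Proof (gaugeExp cfgExp)
open B8Lemma1NonAbelian (mulCfg)
open B8Eq140Level (SideTouches)
open B8Eq146AExpansion (iEta)
open B7Prop4GeneralLevels (logCovIter linCovIter)
open B8Eq155JBound (Jcur wsup)
open B8ScaledSupNorm (bondNorm msup)
open B8Thm2LogB (blockTop)
open B8Ineq130 (tlo thi)
open B8Eq138LandauZd (IsLandau138W logCfg)
open B8Prop3GaugeFixedKLevel (eq_mgauge_inv_of_mgauge_eq mem_unitaryUnits_of_mgauge_eq logField_spec)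
open B8Thm4KLevelBdryBeta (thm4_exists_all_levels_supp_landau138_bdryβ)
open B8Thm4Windows (thm4_windows thm4_windows_extra)
open B8Thm4AtLandau138 (mgauge_mgauge_inv)
open B8LeafModelZd (SockP5base SockP5 ZdIdx)
open B8LeafModelZd3 (mlogCfg mlogCfg_spec zdGF3)
open B9SupplySockB9P3ZdBeta (CrossB)

-- `Site` alone could resolve to the torus sites of `Setup.lean`; re-export the `ℤ^d` sites of `B7Prop1Explicit`.
export B7Prop1Explicit (Site)


variable {d : ℕ}

section Main

variable {𝔸 : Type*} [CStarAlgebra 𝔸] [Nontrivial 𝔸]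

/-! ## §0 Theorem 4's windows one level lower -/

/-- ★ **THEOREM 4's [3]-PROP.-4 WINDOWS ONE LEVEL LOWER** (edition γ): the threshold `c₁∕L²` of dag-n05-a's `B8Thm4Windows.thm4_windows` read at the scaled pair
`(L²α₀, L²α₁)` yields the linearisation windows at `(L²α₀, L·α₂)` and the (1.56)∕(1.61) windows with the remainder constant `C₂ = 16·131072(d+1)²·L²` that
`B8Thm4KLevelGamma.thm4_exists_all_levels_supp_landau138_γ` asks (`α₂ = 2(L c⋆) + 8α₄`, `c⋆ = 5dLB₀(α₀+α₁)`, `α₄ = 8B₀′·5dLB₀·(α₀+α₁)`; `L² α₂ = α₂` of the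
scaled pair).  Elementary monotonicity in `L ≥ 1`. [cite: Balaban1985RegularSpaces, Thm 4 p.88 («there exists a constant c₁»), (1.56) p.86, (1.61) p.86] -/
theorem thm4_windows_γ {d L : ℕ} (hd : 1 ≤ d) (hL : 1 ≤ L) {B₀ B₀' : ℝ} (hB₀ : 0 < B₀) (hB₀' : 0 < B₀')
    (hB : 2 ≤ 5 * (d : ℝ) * L * B₀) :
    ∃ c₁ : ℝ, 0 < c₁ ∧ ∀ α₀ α₁ : ℝ, 0 < α₀ → 0 < α₁ → α₀ + α₁ ≤ c₁ →
      ∀ cstar α₄ : ℝ, cstar = 5 * d * L * B₀ * (α₀ + α₁) → α₄ = 8 * B₀' * (5 * d * L * B₀) * (α₀ + α₁) →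
      C0 d * ((L : ℝ) ^ 2 * α₀) ≤ 1 / 3 ∧ 4 * ((L : ℝ) ^ 2 * α₀) ≤ c2' d L ∧
      16 * ((L : ℝ) * (2 * (L * cstar) + 8 * α₄)) ≤ 1 ∧
      Real.exp (4 * (800 * ((d : ℝ) + 1) ^ 2 * ((d : ℝ) + 4)) * ((L : ℝ) ^ 2 * α₀))
          * (1 + 8 * (131072 * ((d : ℝ) + 1) ^ 2) * ((L : ℝ) * (2 * (L * cstar) + 8 * α₄))) ≤ 2 ∧
      2 * ((L : ℝ) * (2 * (L * cstar) + 8 * α₄)) ≤ c3 d L ∧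
      8 * (131072 * ((d : ℝ) + 1) ^ 2) * Real.exp (4 * (800 * ((d : ℝ) + 1) ^ 2 * ((d : ℝ) + 4)) * ((L : ℝ) ^ 2 * α₀)) * (L : ℝ) ^ 2
          ≤ 16 * (131072 * ((d : ℝ) + 1) ^ 2) * (L : ℝ) ^ 2 ∧
      2 * (2 * (L * cstar) + 8 * α₄) ^ 2 + 20 * d * α₀ * (2 * (L * cstar) + 8 * α₄)
          + 2 * (16 * (131072 * ((d : ℝ) + 1) ^ 2) * (L : ℝ) ^ 2) * (2 * (L * cstar) + 8 * α₄) ^ 2 ≤ α₀ + α₁ := by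
  obtain ⟨c₁, hc₁, hw⟩ := thm4_windows hd hL hB₀ hB₀' hB
  have hL1 : (1 : ℝ) ≤ L := by exact_mod_cast hL
  have hL2 : (1 : ℝ) ≤ (L : ℝ) ^ 2 := one_le_pow₀ hL1
  have hL2pos : (0 : ℝ) < (L : ℝ) ^ 2 := by positivity
  refine ⟨c₁ / (L : ℝ) ^ 2, by positivity, fun α₀ α₁ hα₀ hα₁ hS cstar α₄ hc hα4 => ?_⟩
  have hd0 : (0 : ℝ) ≤ d := Nat.cast_nonneg d
  have hS0 : 0 ≤ α₀ + α₁ := by linarith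
  have hcs0 : 0 ≤ cstar := by rw [hc]; positivity
  have hα40 : 0 ≤ α₄ := by rw [hα4]; positivity
  have hS' : (L : ℝ) ^ 2 * α₀ + (L : ℝ) ^ 2 * α₁ ≤ c₁ := by
    rw [← mul_add]; exact (le_div_iff₀' hL2pos).1 hS
  obtain ⟨-, -, -, -, W5, W6, W7, -, W9, W10, -, -, W13, W14, -, -, -, -⟩ :=
    hw ((L : ℝ) ^ 2 * α₀) ((L : ℝ) ^ 2 * α₁) (by positivity) (by positivity) hS' ((L : ℝ) ^ 2 * cstar) ((L : ℝ) ^ 2 * α₄)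
      (by rw [hc]; ring) (by rw [hα4]; ring)
  -- the scaled `α₂`: `2(L(L²c⋆)) + 8(L²α₄) = L²·α₂ ≥ L·α₂ ≥ α₂`
  set α₂ : ℝ := 2 * (L * cstar) + 8 * α₄ with hα₂_def
  have hα₂0 : 0 ≤ α₂ := by positivity
  have hscale : 2 * ((L : ℝ) * ((L : ℝ) ^ 2 * cstar)) + 8 * ((L : ℝ) ^ 2 * α₄) = (L : ℝ) ^ 2 * α₂ := by rw [hα₂_def]; ring
  rw [hscale] at W7 W9 W10 W14
  have hLL : (L : ℝ) ≤ (L : ℝ) ^ 2 := by nlinarith [hL1]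
  have hmono : (L : ℝ) * α₂ ≤ (L : ℝ) ^ 2 * α₂ := mul_le_mul_of_nonneg_right hLL hα₂0
  have hF0 : (0 : ℝ) ≤ 8 * (131072 * ((d : ℝ) + 1) ^ 2) := by positivity
  have hexp0 : 0 ≤ Real.exp (4 * (800 * ((d : ℝ) + 1) ^ 2 * ((d : ℝ) + 4)) * ((L : ℝ) ^ 2 * α₀)) := (Real.exp_pos _).le
  refine ⟨W5, W6, ?_, ?_, ?_, ?_, ?_⟩
  · linarith [mul_le_mul_of_nonneg_left hmono (by norm_num : (0 : ℝ) ≤ 16)]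
  · have h1 : 1 + 8 * (131072 * ((d : ℝ) + 1) ^ 2) * ((L : ℝ) * α₂) ≤ 1 + 8 * (131072 * ((d : ℝ) + 1) ^ 2) * ((L : ℝ) ^ 2 * α₂) := by
      linarith [mul_le_mul_of_nonneg_left hmono hF0]
    exact (mul_le_mul_of_nonneg_left h1 hexp0).trans W9
  · linarith [mul_le_mul_of_nonneg_left hmono (by norm_num : (0 : ℝ) ≤ 2)]
  · exact mul_le_mul_of_nonneg_right W13 hL2pos.le
  · -- divide W14 by `L²` and use `L² ≥ 1`
    have hα₂sq : 0 ≤ α₂ ^ 2 := sq_nonneg _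
    have hprod : 0 ≤ α₀ * α₂ := mul_nonneg hα₀.le hα₂0
    have hkey : (L : ℝ) ^ 2 * (2 * ((L : ℝ) ^ 2 * α₂ ^ 2) + 20 * d * ((L : ℝ) ^ 2 * (α₀ * α₂))
        + 2 * (16 * (131072 * ((d : ℝ) + 1) ^ 2)) * ((L : ℝ) ^ 2 * α₂ ^ 2)) ≤ (L : ℝ) ^ 2 * (α₀ + α₁) := by
      have e : 2 * ((L : ℝ) ^ 2 * α₂) ^ 2 + 20 * d * ((L : ℝ) ^ 2 * α₀) * ((L : ℝ) ^ 2 * α₂)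
          + 2 * (16 * (131072 * ((d : ℝ) + 1) ^ 2)) * ((L : ℝ) ^ 2 * α₂) ^ 2
          = (L : ℝ) ^ 2 * (2 * ((L : ℝ) ^ 2 * α₂ ^ 2) + 20 * d * ((L : ℝ) ^ 2 * (α₀ * α₂))
            + 2 * (16 * (131072 * ((d : ℝ) + 1) ^ 2)) * ((L : ℝ) ^ 2 * α₂ ^ 2)) := by ring
      have e2 : (L : ℝ) ^ 2 * α₀ + (L : ℝ) ^ 2 * α₁ = (L : ℝ) ^ 2 * (α₀ + α₁) := by ring
      rw [← e, ← e2]; exact W14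
    have hdiv := le_of_mul_le_mul_left hkey hL2pos
    have h1 : α₂ ^ 2 ≤ (L : ℝ) ^ 2 * α₂ ^ 2 := le_mul_of_one_le_left hα₂sq hL2
    have h2 : α₀ * α₂ ≤ (L : ℝ) ^ 2 * (α₀ * α₂) := le_mul_of_one_le_left hprod hL2
    have h3 : 2 * (16 * (131072 * ((d : ℝ) + 1) ^ 2) * (L : ℝ) ^ 2) * α₂ ^ 2
        = 2 * (16 * (131072 * ((d : ℝ) + 1) ^ 2)) * ((L : ℝ) ^ 2 * α₂ ^ 2) := by ring
    rw [h3]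
    nlinarith [h1, h2, hdiv, hd0]

#print axioms thm4_windows_γ

/-! ## §1 Theorem 4, existence half, on the `ℤᵈ` carriers, one threshold, edition γ -/

/-- ★ **THEOREM 4 (p. 88), EXISTENCE HALF, ON THE `ℤᵈ` CARRIERS, ONE THRESHOLD BEFORE THE DATA, EDITION γ** — this seat's
`B8Thm4ExistsZd3BdryBeta.thm4Exists_concrete_uniform_bdryβ` with the datum class `Λb` (a parameter, with `hclass`) under PRINT's box law «box ⊂ Ω_{j−1}»
(`hbox`), the datum's (1.35) asked in print's class (every level-`j` bond whose box lies in `Ω_{j−1}`; Prop. 5's sockets and the β-shaped (1.59) socket keep their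
own (weaker) (1.35) guard and are fed by antitonicity), driven by `B8Thm4KLevelGamma.thm4_exists_all_levels_supp_landau138_γ`; windows from `thm4_windows` at
`(α₀, α₁)` AND `thm4_windows_γ`; the (1.59) socket over `Λb` is the β-shaped two-line body (datum `Λb m j ∪ {level-0 crossing bonds of Ω₀}`), to be supplied at
the cube member over dag-n05-c's print class `cubeLamBP'` by dag-n06-b's γ supplier.  Conclusion verbatim: a unitary `u`, `= 1` off `Ω₀`, with (1.29), (1.38)
(`k ≥ 1`) and the (1.62)-shape with `logCfg`.
[cite: Balaban1985RegularSpaces, Thm 4 p.88, (1.29) p.81, (1.31) p.82, (1.35) p.82, (1.38) p.82, (1.58)–(1.62) pp.86–87, (1.66) p.87, Prop. 5 (1.107)–(1.108) p.94, p.77] -/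
theorem thm4Exists_concrete_uniform_γ (hd2 : 2 ≤ d) {L : ℕ} (hL : 2 ≤ L)
    {B₀ B₀' cP Bbd : ℝ} (hB₀ : 0 < B₀) (hB₀' : 0 < B₀') (hB : 2 ≤ 5 * (d : ℝ) * L * B₀) (hcP : 0 < cP)
    (hBbd : 0 ≤ Bbd) (hBd : 4 * Bbd ≤ ((d : ℝ) * L - 1) * B₀) :
    ∃ c₁ : ℝ, 0 < c₁ ∧ ∀ (η : ℝ), 0 < η → ∀ (k : ℕ)
    (Ω : ℕ → Set (Site d)) (hΩ : ∀ j, Ω (j + 1) ⊆ Ω j) (Λs : ℕ → ℕ → Set (Site d)) (Λb : ℕ → ℕ → Set (Site d × Fin d))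
    -- PRINT's box law (edition γ): the box of a level-`j` datum bond lies in `Ω_{j−1}` ((1.31); level 0: `Ω₀`)
    (hbox : ∀ m, m ≤ k → ∀ j, j ≤ m → ∀ c ∈ Λb m j, ∀ x, InBox (loK L j c.1) (bondHiK L j c.1 c.2) x → x ∈ Ω (j - 1))
    (hclass : ∀ m, m ≤ k → ∀ j, j ≤ m → ∀ c ∈ Λb m j,
      (c.1 ∈ Λs m j ∧ c.1 + e c.2 ∈ Λs m j) ∨
      (∃ j', j = j' + 1 ∧ (∀ x, (L : ℤ) • c.1 ≤ x → x ≤ (L : ℤ) • c.1 + blockTop L → x ∈ Λs m j') ∧ c.1 + e c.2 ∈ Λs m j) ∨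
      (∃ j', j = j' + 1 ∧ c.1 ∈ Λs m j ∧ (∀ x, (L : ℤ) • (c.1 + e c.2) ≤ x → x ≤ (L : ℤ) • (c.1 + e c.2) + blockTop L → x ∈ Λs m j')))
    (hlay : ∀ m, 1 ≤ m → m ≤ k → ∀ y z : Site d, y ∈ Ω 0 → z ∉ Ω 0 → (∀ i, y i - 1 ≤ z i ∧ z i ≤ y i + 1) → y ∈ Λs m 0)
    (SP5base : ∀ α₀ α₁ : ℝ, 0 < α₀ → 0 < α₁ → α₀ + α₁ ≤ cP →
      ∀ U₀ U' : Site d → Fin d → 𝔸ˣ, (∀ x κ, U₀ x κ ∈ unitaryUnits 𝔸) → (∀ x κ, U' x κ ∈ unitaryUnits 𝔸) →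
      InAk L k η α₀ Ω U₀ → InAk L k η α₀ Ω (mulCfg U' U₀) → (∀ m, m ≤ k → InAx L m (Λs m) U₀ (mulCfg U' U₀)) →
      (∀ j, j ≤ k → ∀ (z : Site d) (μ : Fin d), (∀ x, InBox (loK L j z) (bondHiK L j z μ) x → x ∈ Ω j) →
        ‖(avgIter L (mulCfg U' U₀) j z μ : 𝔸) - (avgIter L U₀ j z μ : 𝔸)‖ ≤ α₁) →
      (∀ b ∈ {b : Site d × Fin d | SideTouches (Ω 0) b.1 b.2}, ‖((U' b.1 b.2 : 𝔸ˣ) : 𝔸) - 1‖ ≤ α₁) →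
      (∃ (v : Site d → 𝔸ˣ) (lam : Site d → 𝔸), (∀ x, v x ∈ unitaryUnits 𝔸) ∧ (∀ x, x ∉ Ω 0 → v x = 1) ∧
        (∀ j, j ≤ 1 → ∀ b ∈ {b : Site d × Fin d | SideTouches (Ω j) b.1 b.2}, (v b.1 : 𝔸) = ((gaugeExp lam b.1 : 𝔸ˣ) : 𝔸) ∧
        (v (b.1 + e b.2) : 𝔸) = ((gaugeExp lam (b.1 + e b.2) : 𝔸ˣ) : 𝔸)) ∧
        (∀ j, j ≤ 1 → ∀ b ∈ {b : Site d × Fin d | SideTouches (Ω j) b.1 b.2},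
        ‖lam b.1‖ ≤ (8 * B₀' * (5 * (d : ℝ) * L * B₀) * (α₀ + α₁)) ∧ ((L : ℝ) ^ j * η) * ‖covDerivFwd η U₀ b.2 lam b.1‖ ≤ (8 * B₀' * (5 * (d : ℝ) * L * B₀) * (α₀ + α₁))) ∧
        IsLandau138W L 1 η (Ω 0) (Λs 1) U₀ (mgauge U₀ v⁻¹ U') ∧ Restr129 L 1 (Λs 1) U₀ ((1 : Site d → 𝔸ˣ) * v)))
    (SP5 : ∀ α₀ α₁ : ℝ, 0 < α₀ → 0 < α₁ → α₀ + α₁ ≤ cP →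
      ∀ U₀ U' : Site d → Fin d → 𝔸ˣ, (∀ x κ, U₀ x κ ∈ unitaryUnits 𝔸) → (∀ x κ, U' x κ ∈ unitaryUnits 𝔸) →
      InAk L k η α₀ Ω U₀ → InAk L k η α₀ Ω (mulCfg U' U₀) → (∀ m, m ≤ k → InAx L m (Λs m) U₀ (mulCfg U' U₀)) →
      (∀ j, j ≤ k → ∀ (z : Site d) (μ : Fin d), (∀ x, InBox (loK L j z) (bondHiK L j z μ) x → x ∈ Ω j) →
        ‖(avgIter L (mulCfg U' U₀) j z μ : 𝔸) - (avgIter L U₀ j z μ : 𝔸)‖ ≤ α₁) →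
      (∀ b ∈ {b : Site d × Fin d | SideTouches (Ω 0) b.1 b.2}, ‖((U' b.1 b.2 : 𝔸ˣ) : 𝔸) - 1‖ ≤ α₁) →
      (∀ m, 1 ≤ m → m < k → ∀ (u₁ : Site d → 𝔸ˣ) (U₁ : Site d → Fin d → 𝔸ˣ) (A : Site d → Fin d → 𝔸),
        (∀ x, u₁ x ∈ unitaryUnits 𝔸) → (∀ x, x ∉ Ω 0 → u₁ x = 1) → mgauge U₀ u₁ U₁ = U' → Restr129 L m (Λs m) U₀ u₁ →
        IsLandau138W L m η (Ω 0) (Λs m) U₀ U₁ →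
        (∀ j, j ≤ m → ∀ b ∈ {b : Site d × Fin d | SideTouches (Ω j) b.1 b.2},
        U₁ b.1 b.2 = cfgExp η A b.1 b.2 ∧ IsSelfAdjoint (A b.1 b.2) ∧ ‖A b.1 b.2‖ ≤ (5 * (d : ℝ) * L * B₀ * (α₀ + α₁)) * ((L : ℝ) ^ j * η)⁻¹) →
        ∃ (v : Site d → 𝔸ˣ) (lam : Site d → 𝔸), (∀ x, v x ∈ unitaryUnits 𝔸) ∧ (∀ x, x ∉ Ω 0 → v x = 1) ∧
        (∀ j, j ≤ m + 1 → ∀ b ∈ {b : Site d × Fin d | SideTouches (Ω j) b.1 b.2}, (v b.1 : 𝔸) = ((gaugeExp lam b.1 : 𝔸ˣ) : 𝔸) ∧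
        (v (b.1 + e b.2) : 𝔸) = ((gaugeExp lam (b.1 + e b.2) : 𝔸ˣ) : 𝔸)) ∧
        (∀ j, j ≤ m + 1 → ∀ b ∈ {b : Site d × Fin d | SideTouches (Ω j) b.1 b.2},
        ‖lam b.1‖ ≤ (8 * B₀' * (5 * (d : ℝ) * L * B₀) * (α₀ + α₁)) ∧ ((L : ℝ) ^ j * η) * ‖covDerivFwd η U₀ b.2 lam b.1‖ ≤ (8 * B₀' * (5 * (d : ℝ) * L * B₀) * (α₀ + α₁))) ∧
        IsLandau138W L (m + 1) η (Ω 0) (Λs (m + 1)) U₀ (mgauge U₀ v⁻¹ U₁) ∧ Restr129 L (m + 1) (Λs (m + 1)) U₀ (u₁ * v)))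
    (SH59Dβ : ∀ α₀ α₁ : ℝ, 0 < α₀ → 0 < α₁ → α₀ + α₁ ≤ cP →
      ∀ U₀ U' : Site d → Fin d → 𝔸ˣ, (∀ x κ, U₀ x κ ∈ unitaryUnits 𝔸) → (∀ x κ, U' x κ ∈ unitaryUnits 𝔸) →
      InAk L k η α₀ Ω U₀ → InAk L k η α₀ Ω (mulCfg U' U₀) → (∀ m, m ≤ k → InAx L m (Λs m) U₀ (mulCfg U' U₀)) →
      (∀ j, j ≤ k → ∀ (z : Site d) (μ : Fin d), (∀ x, InBox (loK L j z) (bondHiK L j z μ) x → x ∈ Ω j) →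
        ‖(avgIter L (mulCfg U' U₀) j z μ : 𝔸) - (avgIter L U₀ j z μ : 𝔸)‖ ≤ α₁) →
      (∀ b ∈ {b : Site d × Fin d | SideTouches (Ω 0) b.1 b.2}, ‖((U' b.1 b.2 : 𝔸ˣ) : 𝔸) - 1‖ ≤ α₁) →
      (∀ m, 1 ≤ m → m ≤ k → ∀ (u : Site d → 𝔸ˣ) (W : Site d → Fin d → 𝔸ˣ) (A' : Site d → Fin d → 𝔸),
        (∀ x, u x ∈ unitaryUnits 𝔸) → (∀ x, x ∉ Ω 0 → u x = 1) → mgauge U₀ u W = U' → Restr129 L m (Λs m) U₀ u →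
        IsLandau138W L m η (Ω 0) (Λs m) U₀ W → (∀ y τ, IsSelfAdjoint (A' y τ)) →
        (∀ j, j ≤ m → ∀ y τ, SideTouches (Ω j) y τ →
        W y τ = cfgExp η A' y τ ∧ ‖A' y τ‖ ≤ (2 * (L * (5 * (d : ℝ) * L * B₀ * (α₀ + α₁))) + 8 * (8 * B₀' * (5 * (d : ℝ) * L * B₀) * (α₀ + α₁))) * ((L : ℝ) ^ j * η)⁻¹) →
        (∀ y τ, (∀ j, j ≤ m → ¬ SideTouches (Ω j) y τ) → A' y τ = 0) →
        msup L m η (-(1 : ℝ)) (fun j (b : Site d × Fin d) => SideTouches (Ω j) b.1 b.2) (fun b => A' b.1 b.2)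
        ≤ B₀ * (bondNorm L m η (-(3 : ℝ)) Ω (fun x μ => Jcur η U₀ A' μ x)
        + wsup 1 (fun p : {p : ℕ × (Site d × Fin d) // p.1 ≤ m ∧ (p.2 ∈ Λb m p.1 ∨ (p.1 = 0 ∧ CrossB (Ω 0) p.2))} =>
        linCovIter L U₀ (iEta η A') p.1.1 p.1.2.1 p.1.2.2))
        + Bbd * msup L m η (-(1 : ℝ)) (fun j (b : Site d × Fin d) => j = 0 ∧ SideTouches (Ω 0) b.1 b.2 ∧ ¬ BondTouches (Ω 0) b.1 b.2)
            (fun b => A' b.1 b.2) ∧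
        msup L m η (-(2 : ℝ)) (fun j (t : Fin d × Fin d × Site d) => SideTouches (Ω j) t.2.2 t.2.1)
        (fun t => covDerivFwd η U₀ t.1 (fun z => A' z t.2.1) t.2.2)
        ≤ B₀ * (bondNorm L m η (-(3 : ℝ)) Ω (fun x μ => Jcur η U₀ A' μ x)
        + wsup 1 (fun p : {p : ℕ × (Site d × Fin d) // p.1 ≤ m ∧ (p.2 ∈ Λb m p.1 ∨ (p.1 = 0 ∧ CrossB (Ω 0) p.2))} =>
        linCovIter L U₀ (iEta η A') p.1.1 p.1.2.1 p.1.2.2))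
        + Bbd * msup L m η (-(1 : ℝ)) (fun j (b : Site d × Fin d) => j = 0 ∧ SideTouches (Ω 0) b.1 b.2 ∧ ¬ BondTouches (Ω 0) b.1 b.2)
            (fun b => A' b.1 b.2))),
      ∀ α₀ α₁ : ℝ, 0 < α₀ → 0 < α₁ → α₀ + α₁ ≤ c₁ →
      ∀ U₀ U' : Site d → Fin d → 𝔸ˣ, (∀ x κ, U₀ x κ ∈ unitaryUnits 𝔸) → (∀ x κ, U' x κ ∈ unitaryUnits 𝔸) →
      InAk L k η α₀ Ω U₀ → InAk L k η α₀ Ω (mulCfg U' U₀) → (∀ m, m ≤ k → InAx L m (Λs m) U₀ (mulCfg U' U₀)) →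
      -- (1.35) for the datum in PRINT's class: every level-`j` bond whose box lies in `Ω_{j−1}` (p. 77 «at least one end-point in Ω»)
      (∀ j, j ≤ k → ∀ (z : Site d) (μ : Fin d), (∀ x, InBox (loK L j z) (bondHiK L j z μ) x → x ∈ Ω (j - 1)) →
        ‖(avgIter L (mulCfg U' U₀) j z μ : 𝔸) - (avgIter L U₀ j z μ : 𝔸)‖ ≤ α₁) →
      (∀ b ∈ {b : Site d × Fin d | SideTouches (Ω 0) b.1 b.2}, ‖((U' b.1 b.2 : 𝔸ˣ) : 𝔸) - 1‖ ≤ α₁) →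
      ∃ u : Site d → 𝔸ˣ, (∀ x, u x ∈ unitaryUnits 𝔸) ∧ (∀ x, x ∉ Ω 0 → u x = 1) ∧ Restr129 L k (Λs k) U₀ u ∧
        (1 ≤ k → IsLandau138W L k η (Ω 0) (Λs k) U₀ (mgauge U₀ u⁻¹ U')) ∧
        (∀ j, j ≤ k → ∀ b ∈ {b : Site d × Fin d | SideTouches (Ω j) b.1 b.2},
          mgauge U₀ u⁻¹ U' b.1 b.2 = cfgExp η (logCfg η (mgauge U₀ u⁻¹ U')) b.1 b.2 ∧
            IsSelfAdjoint (logCfg η (mgauge U₀ u⁻¹ U') b.1 b.2) ∧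
            ‖logCfg η (mgauge U₀ u⁻¹ U') b.1 b.2‖ ≤ (5 * (d : ℝ) * L * B₀ * (α₀ + α₁)) * ((L : ℝ) ^ j * η)⁻¹) := by
  have hL1 : 1 ≤ L := le_trans (by norm_num) hL
  have hd1 : 1 ≤ d := le_trans (by norm_num) hd2
  have hd' : (1 : ℝ) ≤ d := by exact_mod_cast hd1
  have hL' : (1 : ℝ) ≤ L := by exact_mod_cast hL1
  obtain ⟨c₁, hc₁, hw⟩ := thm4_windows hd1 hL1 hB₀ hB₀' hB
  obtain ⟨c₂, hc₂, hw'⟩ := thm4_windows_extra (d := d) hL1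
  obtain ⟨c₃, hc₃γ, hwγ⟩ := thm4_windows_γ hd1 hL1 hB₀ hB₀' hB
  refine ⟨min (min c₁ c₂) (min cP c₃), lt_min (lt_min hc₁ hc₂) (lt_min hcP hc₃γ), ?_⟩
  intro η hη k Ω hΩ Λs Λb hbox hclass hlay SP5base SP5 SH59Dβ α₀ α₁ hα₀ hα₁ hS U₀ U' hU₀ hU' h33 h34 hAx h135 h66
  have hS1 : α₀ + α₁ ≤ c₁ := hS.trans ((min_le_left _ _).trans (min_le_left _ _))
  have hS2 : α₀ + α₁ ≤ c₂ := hS.trans ((min_le_left _ _).trans (min_le_right _ _))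
  have hSP : α₀ + α₁ ≤ cP := hS.trans ((min_le_right _ _).trans (min_le_left _ _))
  have hS3 : α₀ + α₁ ≤ c₃ := hS.trans ((min_le_right _ _).trans (min_le_right _ _))
  have hS0 : 0 ≤ α₀ + α₁ := by linarith
  obtain ⟨w1, w2, w3, w4, w5, w6, w7, w8, w9, w10, w11, w12, w13, w14, w15, w16, w17, w18⟩ :=
    hw α₀ α₁ hα₀ hα₁ hS1 (5 * (d : ℝ) * L * B₀ * (α₀ + α₁)) (8 * B₀' * (5 * (d : ℝ) * L * B₀) * (α₀ + α₁)) rfl rfl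
  obtain ⟨w19, w20⟩ := hw' α₀ α₁ hα₀ hα₁ hS2
  obtain ⟨g5, g6, g7, g9, g10, g13, g14⟩ :=
    hwγ α₀ α₁ hα₀ hα₁ hS3 (5 * (d : ℝ) * L * B₀ * (α₀ + α₁)) (8 * B₀' * (5 * (d : ℝ) * L * B₀) * (α₀ + α₁)) rfl rfl
  -- the old-guard (1.35) for Proposition 5's sockets and the β-shaped socket: boxes in `Ω_j` lie in `Ω_{j−1}`
  have hΩp : ∀ j, Ω j ⊆ Ω (j - 1) := by
    intro j x hx
    rcases Nat.eq_zero_or_pos j with rfl | hjp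
    · simpa using hx
    · obtain ⟨i, rfl⟩ : ∃ i, j = i + 1 := ⟨j - 1, by omega⟩
      rw [Nat.add_sub_cancel]; exact hΩ i hx
  have h135o : ∀ j, j ≤ k → ∀ (z : Site d) (μ : Fin d), (∀ x, InBox (loK L j z) (bondHiK L j z μ) x → x ∈ Ω j) →
      ‖(avgIter L (mulCfg U' U₀) j z μ : 𝔸) - (avgIter L U₀ j z μ : 𝔸)‖ ≤ α₁ :=
    fun j hj z μ hg => h135 j hj z μ fun x hx => hΩp j (hg x hx)
  have hcs0 : 0 ≤ 5 * (d : ℝ) * L * B₀ * (α₀ + α₁) := by positivity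
  have hα₄0 : 0 ≤ 8 * B₀' * (5 * (d : ℝ) * L * B₀) * (α₀ + α₁) := by positivity
  -- EXISTENCE (support form) at the top level `k`
  -- the exterior-collar window at the datum's (1.66)₀ level `a := α₁`
  have hbdry : 4 * Bbd * α₁ ≤ ((d : ℝ) * L - 1) * B₀ * (α₀ + α₁) := by
    have h1 : 4 * Bbd * α₁ ≤ ((d : ℝ) * L - 1) * B₀ * α₁ := mul_le_mul_of_nonneg_right hBd hα₁.le
    have h2 : 0 ≤ ((d : ℝ) * L - 1) * B₀ := le_trans (by positivity) hBd
    have h3 : ((d : ℝ) * L - 1) * B₀ * α₁ ≤ ((d : ℝ) * L - 1) * B₀ * (α₀ + α₁) :=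
      mul_le_mul_of_nonneg_left (le_add_of_nonneg_left hα₀.le) h2
    exact h1.trans h3
  obtain ⟨u, hu, huS, h129, W, hW, hLan, A, hA⟩ := B8Thm4KLevelGamma.thm4_exists_all_levels_supp_landau138_γ hd2 hη hL k hU₀ hU'
    hα₀ hα₁ hα₄0 hB₀.le rfl w1 w2 w3 w4 g5 g6 g7 w7 w8 g9 g10 w11 w12 w19 hBbd hα₁.le hbdry g13 g14 Ω hΩ Λs Λb hbox hclass h33 h34 hAx
    h135 h66 hlay (le_mul_of_one_le_left hα₁.le (one_le_mul_of_one_le_of_one_le hd' hL'))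
    (SP5base α₀ α₁ hα₀ hα₁ hSP U₀ U' hU₀ hU' h33 h34 hAx h135o h66) (SP5 α₀ α₁ hα₀ hα₁ hSP U₀ U' hU₀ hU' h33 h34 hAx h135o h66)
    (SH59Dβ α₀ α₁ hα₀ hα₁ hSP U₀ U' hU₀ hU' h33 h34 hAx h135o h66) k le_rfl
  have hWeq : W = mgauge U₀ u⁻¹ U' := eq_mgauge_inv_of_mgauge_eq hW
  have hWu : ∀ x κ, W x κ ∈ unitaryUnits 𝔸 := mem_unitaryUnits_of_mgauge_eq hU₀ hU' hu hW
  -- `c⋆ ≤ 1/16` for the logarithm device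
  have hc16 : 5 * (d : ℝ) * L * B₀ * (α₀ + α₁) ≤ 1 / 16 := by
    have h₁ : (1 : ℝ) * (5 * (d : ℝ) * L * B₀ * (α₀ + α₁)) ≤ L * (5 * (d : ℝ) * L * B₀ * (α₀ + α₁)) :=
      mul_le_mul_of_nonneg_right hL' hcs0
    linarith
  -- the exponent read back as `logCfg`
  have hleaf : ∀ j, j ≤ k → ∀ b ∈ {b : Site d × Fin d | SideTouches (Ω j) b.1 b.2},
      mgauge U₀ u⁻¹ U' b.1 b.2 = cfgExp η (logCfg η (mgauge U₀ u⁻¹ U')) b.1 b.2 ∧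
        IsSelfAdjoint (logCfg η (mgauge U₀ u⁻¹ U') b.1 b.2) ∧
        ‖logCfg η (mgauge U₀ u⁻¹ U') b.1 b.2‖ ≤ (5 * (d : ℝ) * L * B₀ * (α₀ + α₁)) * ((L : ℝ) ^ j * η)⁻¹ := by
    intro j hj b hb
    obtain ⟨hexp, -, hbd⟩ := hA j hj b hb
    have hbd' : ‖A b.1 b.2‖ ≤ (5 * (d : ℝ) * L * B₀ * (α₀ + α₁)) * η⁻¹ := by
      refine hbd.trans ?_
      have hLj : (1 : ℝ) ≤ (L : ℝ) ^ j := one_le_pow₀ hL'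
      have : ((L : ℝ) ^ j * η)⁻¹ ≤ η⁻¹ := by
        rw [mul_inv]
        calc ((L : ℝ) ^ j)⁻¹ * η⁻¹ ≤ 1 * η⁻¹ := by gcongr; exact inv_le_one_of_one_le₀ hLj
          _ = η⁻¹ := one_mul _
      exact mul_le_mul_of_nonneg_left this hcs0
    obtain ⟨hlogA, hsa, hWexp⟩ := logField_spec hη U₀ hWu hexp hbd' hc16
    rw [← hWeq]
    refine ⟨hWexp, ?_, ?_⟩
    · simpa [logCfg] using hsa
    · show ‖logCfg η W b.1 b.2‖ ≤ _
      rw [logCfg, hlogA]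
      exact hbd
  exact ⟨u, hu, huS, h129, fun hk => hWeq ▸ hLan hk, hleaf⟩

end Main

#print axioms thm4Exists_concrete_uniform_γ

end Literature.MathematicalPhysics.QuantumFieldTheory.Balaban1983to89.B8Thm4ExistsConcreteGamma

end
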